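import Mathlib
import Literature.ModelTheory.Zilber.EAC
import Literature.NumberTheory.Transcendental.ExpVarietiesProofs
import Literature.NumberTheory.Transcendental.ExpVarietiesDimension

/-!
# The lattice change of coordinates `(x, y) ↦ (U x, y^U)` on `ℂⁿ × Gⁿ` (`U ∈ GLₙ(ℤ)`)

Set-theoretic and analytic half of the **unimodular-reduction task T12** for the periodic
sub-cell of `EC(3,2)` (seat-1 handoff O21 of the `pub-schanuel` EAC ladder; Mantova–Masser 2024
§1: after a change of coordinates by `GLₙ(ℤ)` an integer period of the base may be taken to be a
coordinate vector).  For an integer matrix `U` we define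

* `intLinMap U : Kⁿ → Kⁿ`, `x ↦ U x` (the additive side);
* `monomialMapUnits U : (Kˣ)ⁿ → (Kˣ)ⁿ`, `y ↦ y^U = (∏ⱼ yⱼ ^ U i j)ᵢ` (the multiplicative side, a
  group endomorphism of the torus), and its `K`-valued shadow `monomialMap U`;
* `latticeChange U : Kⁿ × Kⁿ → Kⁿ × Kⁿ`, `(x, y) ↦ (U x, y^U)` (values off the torus are junk);

and prove: functoriality `U V ↦` composition and `1 ↦ id` (so an inverse pair `U V = V U = 1`
acts by mutually inverse bijections of the torus locus), compatibility with the exponential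
graph over `ℂ` (`exp (U x) = (exp x)^U`, so `latticeChange U` maps `Γ_exp` to `Γ_exp` and, for an
inverse pair, `S ∩ Γ_exp ≠ ∅ ↔ Φ_U(S ∩ Gⁿ) ∩ Γ_exp ≠ ∅`), the additive projection of the image
(`π(Φ_U(S ∩ Gⁿ)) = U · π(S ∩ Gⁿ)`), and the transport of integer translation-invariance of the
base (`B + ℤ v ⊆ B ⇒ U B + ℤ (U v) ⊆ U B`).  The algebraic half of T12 (closedness,
irreducibility, dimension, rotundity and freeness of the transported variety) is NOT done here.

Honest placement: elementary; nothing about `EC(3,2)` (OPEN) or Schanuel's conjecture is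
asserted. [folklore]
-/

namespace Literature.ModelTheory.Zilber

open Literature.NumberTheory.Transcendental Matrix

variable {K : Type*} [Field K] {n : ℕ}

/-! ## The additive side: `x ↦ U x` -/

/-- The linear map of an integer matrix on `Kⁿ`: `(U x)_i = ∑ⱼ U i j · xⱼ`. [folklore] -/
def intLinMap (U : Matrix (Fin n) (Fin n) ℤ) (x : Fin n → K) : Fin n → K :=
  fun i => ∑ j, (U i j : K) * x j

/-- `intLinMap U` is `mulVec` by the cast matrix. [folklore] -/
theorem intLinMap_eq_mulVec (U : Matrix (Fin n) (Fin n) ℤ) (x : Fin n → K) :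
    intLinMap U x = (U.map (Int.cast : ℤ → K)) *ᵥ x := by
  funext i
  rfl

/-- Functoriality: `(U V) x = U (V x)`. [folklore] -/
theorem intLinMap_mul (U V : Matrix (Fin n) (Fin n) ℤ) (x : Fin n → K) :
    intLinMap (U * V) x = intLinMap U (intLinMap V x) := by
  rw [intLinMap_eq_mulVec, intLinMap_eq_mulVec, intLinMap_eq_mulVec, Matrix.mulVec_mulVec]
  congr 1
  exact Matrix.map_mul (f := Int.castRingHom K)

/-- `1 x = x`. [folklore] -/
@[simp] theorem intLinMap_one (x : Fin n → K) : intLinMap (1 : Matrix (Fin n) (Fin n) ℤ) x = x := by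
  rw [intLinMap_eq_mulVec, Matrix.map_one Int.cast Int.cast_zero Int.cast_one, Matrix.one_mulVec]

/-- `intLinMap U` is additive. [folklore] -/
theorem intLinMap_add (U : Matrix (Fin n) (Fin n) ℤ) (x x' : Fin n → K) :
    intLinMap U (x + x') = intLinMap U x + intLinMap U x' := by
  rw [intLinMap_eq_mulVec, intLinMap_eq_mulVec, intLinMap_eq_mulVec, Matrix.mulVec_add]

/-- `intLinMap U` commutes with integer scalars: `U (k • v) = k • U v` for `v ∈ ℤⁿ` cast to `Kⁿ`,
in the form `U (x + k • v) = U x + k • U v`. [folklore] -/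
theorem intLinMap_add_zsmul (U : Matrix (Fin n) (Fin n) ℤ) (x : Fin n → K) (k : ℤ)
    (v : Fin n → K) :
    intLinMap U (x + k • v) = intLinMap U x + k • intLinMap U v := by
  rw [intLinMap_add]
  congr 1
  funext i
  simp only [intLinMap, Pi.smul_apply, zsmul_eq_mul, Finset.mul_sum]
  exact Finset.sum_congr rfl fun j _ => by ring

/-- On integer vectors `intLinMap U` is `U *ᵥ ·` followed by the cast. [folklore] -/
theorem intLinMap_intCast (U : Matrix (Fin n) (Fin n) ℤ) (v : Fin n → ℤ) :
    intLinMap U (fun j => (v j : K)) = fun i => ((U *ᵥ v) i : K) := by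
  funext i
  simp only [intLinMap, Matrix.mulVec, dotProduct, Int.cast_sum, Int.cast_mul]

/-! ## The multiplicative side: `y ↦ y^U` on the torus -/

/-- `∏ᵢ a ^ f i = a ^ ∑ᵢ f i` for integer exponents in a commutative group. [folklore] -/
theorem prod_zpow_eq_zpow_sum {G ι : Type*} [CommGroup G] [DecidableEq ι] (s : Finset ι)
    (f : ι → ℤ) (a : G) : ∏ i ∈ s, a ^ f i = a ^ ∑ i ∈ s, f i := by
  induction s using Finset.induction_on with
  | empty => simp
  | insert i s hi ih => rw [Finset.prod_insert hi, Finset.sum_insert hi, _root_.zpow_add, ih]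

/-- The monomial endomorphism of the torus `(Kˣ)ⁿ` attached to an integer matrix:
`(y^U)_i = ∏ⱼ yⱼ ^ U i j`. [folklore] -/
def monomialMapUnits (U : Matrix (Fin n) (Fin n) ℤ) (y : Fin n → Kˣ) : Fin n → Kˣ :=
  fun i => ∏ j, y j ^ U i j

/-- Functoriality: `y^(U V) = (y^V)^U`. [folklore] -/
theorem monomialMapUnits_mul (U V : Matrix (Fin n) (Fin n) ℤ) (y : Fin n → Kˣ) :
    monomialMapUnits (U * V) y = monomialMapUnits U (monomialMapUnits V y) := by
  classical
  funext i
  simp only [monomialMapUnits, Matrix.mul_apply]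
  -- `∏ k, y k ^ (∑ j, U i j * V j k) = ∏ j, (∏ k, y k ^ V j k) ^ U i j`
  calc ∏ k, y k ^ ∑ j, U i j * V j k
      = ∏ k, ∏ j, y k ^ (U i j * V j k) := by
        refine Finset.prod_congr rfl fun k _ => ?_
        rw [prod_zpow_eq_zpow_sum]
    _ = ∏ j, ∏ k, y k ^ (U i j * V j k) := Finset.prod_comm
    _ = ∏ j, (∏ k, y k ^ V j k) ^ U i j := by
        refine Finset.prod_congr rfl fun j _ => ?_
        rw [← Finset.prod_zpow]
        exact Finset.prod_congr rfl fun k _ => by rw [mul_comm, _root_.zpow_mul]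

/-- `y^1 = y`. [folklore] -/
@[simp] theorem monomialMapUnits_one (y : Fin n → Kˣ) :
    monomialMapUnits (1 : Matrix (Fin n) (Fin n) ℤ) y = y := by
  classical
  funext i
  simp only [monomialMapUnits, Matrix.one_apply]
  rw [Finset.prod_eq_single i (fun j _ hj => by rw [if_neg (Ne.symm hj), zpow_zero])
    (fun h => absurd (Finset.mem_univ i) h), if_pos rfl, zpow_one]

/-- An inverse pair acts by mutually inverse maps of the torus. [folklore] -/
theorem monomialMapUnits_leftInverse {U V : Matrix (Fin n) (Fin n) ℤ} (h : V * U = 1) :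
    Function.LeftInverse (monomialMapUnits (K := K) V) (monomialMapUnits U) := fun y => by
  rw [← monomialMapUnits_mul, h, monomialMapUnits_one]

/-- For an inverse pair the monomial map is a bijection of the torus. [folklore] -/
theorem monomialMapUnits_bijective {U V : Matrix (Fin n) (Fin n) ℤ} (hVU : V * U = 1)
    (hUV : U * V = 1) : Function.Bijective (monomialMapUnits (K := K) U) :=
  ⟨(monomialMapUnits_leftInverse hVU).injective,
    (monomialMapUnits_leftInverse hUV).surjective⟩

/-- The `K`-valued monomial map `(y^U)_i = ∏ⱼ yⱼ ^ U i j` (integer powers in the field; junk at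
`yⱼ = 0` with a negative exponent). [folklore] -/
noncomputable def monomialMap (U : Matrix (Fin n) (Fin n) ℤ) (y : Fin n → K) : Fin n → K :=
  fun i => ∏ j, y j ^ U i j

/-- On the torus the `K`-valued monomial map is the shadow of the group one. [folklore] -/
theorem monomialMap_coe_units (U : Matrix (Fin n) (Fin n) ℤ) (y : Fin n → Kˣ) :
    monomialMap U (fun j => (y j : K)) = fun i => ((monomialMapUnits U y) i : K) := by
  funext i
  simp only [monomialMap, monomialMapUnits, Units.coe_prod, Units.val_zpow_eq_zpow_val]

/-- The monomial map of a vector with nonzero coordinates has nonzero coordinates. [folklore] -/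
theorem monomialMap_ne_zero (U : Matrix (Fin n) (Fin n) ℤ) {y : Fin n → K} (hy : ∀ j, y j ≠ 0)
    (i : Fin n) : monomialMap U y i ≠ 0 :=
  Finset.prod_ne_zero_iff.2 fun j _ => zpow_ne_zero _ (hy j)

/-- Functoriality on vectors with nonzero coordinates. [folklore] -/
theorem monomialMap_mul (U V : Matrix (Fin n) (Fin n) ℤ) {y : Fin n → K} (hy : ∀ j, y j ≠ 0) :
    monomialMap (U * V) y = monomialMap U (monomialMap V y) := by
  set u : Fin n → Kˣ := fun j => Units.mk0 (y j) (hy j) with hu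
  have hyu : y = fun j => (u j : K) := funext fun j => by simp [hu]
  rw [hyu, monomialMap_coe_units, monomialMap_coe_units, monomialMap_coe_units,
    monomialMapUnits_mul]

/-- `y^1 = y`. [folklore] -/
@[simp] theorem monomialMap_one (y : Fin n → K) :
    monomialMap (1 : Matrix (Fin n) (Fin n) ℤ) y = y := by
  classical
  funext i
  simp only [monomialMap, Matrix.one_apply]
  rw [Finset.prod_eq_single i (fun j _ hj => by rw [if_neg (Ne.symm hj), zpow_zero])
    (fun h => absurd (Finset.mem_univ i) h), if_pos rfl, zpow_one]

/-! ## The change of coordinates on `Kⁿ × Kⁿ` and the torus locus -/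

/-- The lattice change of coordinates `Φ_U (x, y) = (U x, y^U)`. [folklore] -/
noncomputable def latticeChange (U : Matrix (Fin n) (Fin n) ℤ) (z : Fin n ⊕ Fin n → K) :
    Fin n ⊕ Fin n → K :=
  Sum.elim (intLinMap U (projAdd z)) (monomialMap U (projMul z))

/-- Additive coordinates of `Φ_U z`. [folklore] -/
@[simp] theorem latticeChange_inl (U : Matrix (Fin n) (Fin n) ℤ) (z : Fin n ⊕ Fin n → K)
    (i : Fin n) : latticeChange U z (Sum.inl i) = intLinMap U (projAdd z) i := rfl

/-- Multiplicative coordinates of `Φ_U z`. [folklore] -/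
@[simp] theorem latticeChange_inr (U : Matrix (Fin n) (Fin n) ℤ) (z : Fin n ⊕ Fin n → K)
    (i : Fin n) : latticeChange U z (Sum.inr i) = monomialMap U (projMul z) i := rfl

/-- `π(Φ_U z) = U π(z)`. [folklore] -/
theorem projAdd_latticeChange (U : Matrix (Fin n) (Fin n) ℤ) (z : Fin n ⊕ Fin n → K) :
    projAdd (latticeChange U z) = intLinMap U (projAdd z) := rfl

/-- `π_mul(Φ_U z) = π_mul(z)^U`. [folklore] -/
theorem projMul_latticeChange (U : Matrix (Fin n) (Fin n) ℤ) (z : Fin n ⊕ Fin n → K) :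
    projMul (latticeChange U z) = monomialMap U (projMul z) := rfl

/-- `Φ_U` preserves the torus locus. [folklore] -/
theorem latticeChange_mem_torusLocus (U : Matrix (Fin n) (Fin n) ℤ) {z : Fin n ⊕ Fin n → K}
    (hz : z ∈ torusLocus K n) : latticeChange U z ∈ torusLocus K n := fun i =>
  monomialMap_ne_zero U (fun j => hz j) i

/-- Functoriality of `Φ` on the torus locus. [folklore] -/
theorem latticeChange_mul (U V : Matrix (Fin n) (Fin n) ℤ) {z : Fin n ⊕ Fin n → K}
    (hz : z ∈ torusLocus K n) :
    latticeChange (U * V) z = latticeChange U (latticeChange V z) := by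
  funext i
  cases i with
  | inl i => simp only [latticeChange_inl, projAdd_latticeChange, intLinMap_mul]
  | inr i =>
      simp only [latticeChange_inr, projMul_latticeChange]
      rw [monomialMap_mul U V (fun j => projMul_apply z j ▸ hz j)]

/-- `Φ_1 = id`. [folklore] -/
@[simp] theorem latticeChange_one (z : Fin n ⊕ Fin n → K) :
    latticeChange (1 : Matrix (Fin n) (Fin n) ℤ) z = z := by
  funext i
  cases i with
  | inl i => simp [latticeChange_inl, projAdd]
  | inr i => simp [latticeChange_inr, projMul]

/-- An inverse pair `V U = 1` acts by mutually inverse maps on the torus locus. [folklore] -/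
theorem latticeChange_latticeChange_of_mul_eq_one {U V : Matrix (Fin n) (Fin n) ℤ}
    (h : V * U = 1) {z : Fin n ⊕ Fin n → K} (hz : z ∈ torusLocus K n) :
    latticeChange V (latticeChange U z) = z := by
  rw [← latticeChange_mul V U hz, h, latticeChange_one]

/-- The transported set `Φ_U(S ∩ Gⁿ)`. [folklore] -/
noncomputable def latticeImage (U : Matrix (Fin n) (Fin n) ℤ) (S : Set (Fin n ⊕ Fin n → K)) :
    Set (Fin n ⊕ Fin n → K) :=
  latticeChange U '' (S ∩ torusLocus K n)

/-- `Φ_U(S ∩ Gⁿ) ⊆ Gⁿ`. [folklore] -/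
theorem latticeImage_subset_torusLocus (U : Matrix (Fin n) (Fin n) ℤ)
    (S : Set (Fin n ⊕ Fin n → K)) : latticeImage U S ⊆ torusLocus K n := by
  rintro _ ⟨z, hz, rfl⟩
  exact latticeChange_mem_torusLocus U hz.2

/-- `Φ_U(S ∩ Gⁿ) ∩ Gⁿ = Φ_U(S ∩ Gⁿ)`. [folklore] -/
theorem latticeImage_inter_torusLocus (U : Matrix (Fin n) (Fin n) ℤ)
    (S : Set (Fin n ⊕ Fin n → K)) : latticeImage U S ∩ torusLocus K n = latticeImage U S :=
  Set.inter_eq_left.2 (latticeImage_subset_torusLocus U S)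

/-- For an inverse pair, `Φ_V(Φ_U(S ∩ Gⁿ) ∩ Gⁿ) = S ∩ Gⁿ`. [folklore] -/
theorem latticeImage_latticeImage_of_mul_eq_one {U V : Matrix (Fin n) (Fin n) ℤ}
    (h : V * U = 1) (S : Set (Fin n ⊕ Fin n → K)) :
    latticeImage V (latticeImage U S) = S ∩ torusLocus K n := by
  rw [latticeImage, latticeImage_inter_torusLocus]
  ext z
  constructor
  · rintro ⟨_, ⟨z, hz, rfl⟩, rfl⟩
    rw [latticeChange_latticeChange_of_mul_eq_one h hz.2]
    exact hz
  · intro hz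
    exact ⟨latticeChange U z, ⟨z, hz, rfl⟩, latticeChange_latticeChange_of_mul_eq_one h hz.2⟩

/-- The additive projection of the transported set: `π(Φ_U(S ∩ Gⁿ)) = U · π(S ∩ Gⁿ)`. [folklore] -/
theorem projAdd_image_latticeImage (U : Matrix (Fin n) (Fin n) ℤ)
    (S : Set (Fin n ⊕ Fin n → K)) :
    projAdd '' latticeImage U S = intLinMap U '' (projAdd '' (S ∩ torusLocus K n)) := by
  rw [latticeImage, Set.image_image, Set.image_image]
  rfl

/-- Transport of integer translation-invariance of a base: if `B + k v ⊆ B` for all `k ∈ ℤ` then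
`U B + k (U v) ⊆ U B`. [folklore] -/
theorem intLinMap_image_transl_invariant (U : Matrix (Fin n) (Fin n) ℤ) {B : Set (Fin n → K)}
    {v : Fin n → K} (hB : ∀ b ∈ B, ∀ k : ℤ, b + k • v ∈ B) :
    ∀ b' ∈ intLinMap U '' B, ∀ k : ℤ, b' + k • intLinMap U v ∈ intLinMap U '' B := by
  rintro _ ⟨b, hb, rfl⟩ k
  exact ⟨b + k • v, hB b hb k, intLinMap_add_zsmul U b k v⟩

/-! ## Compatibility with the exponential graph over `ℂ` -/

section Complex

open Literature.ModelTheory.ExponentialFields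

/-- `exp (U x)_i = ∏ⱼ exp(xⱼ) ^ U i j`: the exponential intertwines `x ↦ U x` and `y ↦ y^U`.
[folklore] -/
theorem cexp_intLinMap (U : Matrix (Fin n) (Fin n) ℤ) (x : Fin n → ℂ) (i : Fin n) :
    Complex.exp (intLinMap U x i) = monomialMap U (fun j => Complex.exp (x j)) i := by
  simp only [intLinMap, monomialMap, Complex.exp_sum, Complex.exp_int_mul]

/-- `Φ_U` maps the exponential graph into itself. [folklore] -/
theorem latticeChange_mem_expGraph {U : Matrix (Fin n) (Fin n) ℤ} {z : Fin n ⊕ Fin n → ℂ}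
    (hz : z ∈ expGraph ℂ n) : latticeChange U z ∈ expGraph ℂ n := by
  rw [mem_expGraph_iff] at hz ⊢
  intro i
  rw [latticeChange_inr, latticeChange_inl, ExponentialRing.complex_exp_eq, cexp_intLinMap]
  congr 1
  funext j
  rw [projMul_apply, hz j, ExponentialRing.complex_exp_eq]
  rfl

/-- For an inverse pair, `Φ_U z ∈ Γ_exp ↔ z ∈ Γ_exp` on the torus locus. [folklore] -/
theorem latticeChange_mem_expGraph_iff {U V : Matrix (Fin n) (Fin n) ℤ} (h : V * U = 1)
    {z : Fin n ⊕ Fin n → ℂ} (hz : z ∈ torusLocus ℂ n) :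
    latticeChange U z ∈ expGraph ℂ n ↔ z ∈ expGraph ℂ n := by
  refine ⟨fun hΓ => ?_, latticeChange_mem_expGraph⟩
  have := latticeChange_mem_expGraph (U := V) hΓ
  rwa [latticeChange_latticeChange_of_mul_eq_one h hz] at this

/-- **Exponential points are transported**: for an inverse pair `V U = 1`,
`S ∩ Γ_exp ≠ ∅ ↔ Φ_U(S ∩ Gⁿ) ∩ Γ_exp ≠ ∅` (recall `Γ_exp ⊆ Gⁿ`). This is the step of the
periodic-cell reduction that moves the sought exponential point back and forth. [folklore] -/
theorem latticeImage_inter_expGraph_nonempty_iff {U V : Matrix (Fin n) (Fin n) ℤ} (h : V * U = 1)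
    (S : Set (Fin n ⊕ Fin n → ℂ)) :
    (latticeImage U S ∩ expGraph ℂ n).Nonempty ↔ (S ∩ expGraph ℂ n).Nonempty := by
  constructor
  · rintro ⟨_, ⟨z, hz, rfl⟩, hΓ⟩
    exact ⟨z, hz.1, (latticeChange_mem_expGraph_iff h hz.2).1 hΓ⟩
  · rintro ⟨z, hzS, hzΓ⟩
    exact ⟨latticeChange U z, ⟨z, ⟨hzS, expGraph_subset_torusLocus hzΓ⟩, rfl⟩,
      latticeChange_mem_expGraph hzΓ⟩

end Complex


/-! ## The algebraic side of `x ↦ U x`: the substitution endomorphism `X_i ↦ ∑ⱼ U i j Xⱼ` of `K[X]`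

For the base of a cell member (a closed subset of `Kⁿ`) the change of coordinates `x ↦ U x` is
implemented on polynomials by `linSubst U`, with `eval x (linSubst U p) = eval (U x) p`.  For an
inverse pair this is a `K`-algebra automorphism, so Zariski-closedness, irreducibility and the
dimension of a subset of `Kⁿ` are invariant under `S ↦ U '' S` — the base-side transport needed by
the periodic-cell reduction (T12). [folklore] -/

section LinSubst

variable {K : Type*} [Field K] {n : ℕ}

open MvPolynomial

/-- `linSubst U : K[X₁..Xₙ] → K[X₁..Xₙ]`, `Xᵢ ↦ ∑ⱼ (U i j) Xⱼ`. [folklore] -/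
noncomputable def linSubst (U : Matrix (Fin n) (Fin n) ℤ) :
    MvPolynomial (Fin n) K →ₐ[K] MvPolynomial (Fin n) K :=
  aeval fun i => ∑ j, C ((U i j : ℤ) : K) * X j

/-- `linSubst U Xᵢ = ∑ⱼ (U i j) Xⱼ`. [folklore] -/
theorem linSubst_X (U : Matrix (Fin n) (Fin n) ℤ) (i : Fin n) :
    linSubst U (X i : MvPolynomial (Fin n) K) = ∑ j, C ((U i j : ℤ) : K) * X j :=
  aeval_X _ _

/-- **Evaluation rule**: `eval x (linSubst U p) = eval (U x) p`. [folklore] -/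
theorem eval_linSubst (U : Matrix (Fin n) (Fin n) ℤ) (x : Fin n → K)
    (p : MvPolynomial (Fin n) K) : eval x (linSubst U p) = eval (intLinMap U x) p := by
  have h1 : (aeval x).comp (linSubst (K := K) U) = aeval (intLinMap U x) := by
    rw [linSubst, comp_aeval]
    congr 1
    funext i
    simp only [map_sum, map_mul, aeval_C, aeval_X, intLinMap, Algebra.algebraMap_self_apply]
  have h2 := DFunLike.congr_fun h1 p
  rw [AlgHom.comp_apply] at h2
  exact h2

/-- Evaluation rule in `aeval` form. [folklore] -/
theorem aeval_linSubst (U : Matrix (Fin n) (Fin n) ℤ) (x : Fin n → K)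
    (p : MvPolynomial (Fin n) K) : aeval x (linSubst U p) = aeval (intLinMap U x) p :=
  eval_linSubst U x p

/-- Functoriality (contravariant): `linSubst U ∘ linSubst V = linSubst (V U)`. [folklore] -/
theorem linSubst_comp (U V : Matrix (Fin n) (Fin n) ℤ) :
    (linSubst (K := K) U).comp (linSubst V) = linSubst (V * U) := by
  refine algHom_ext fun i => ?_
  rw [AlgHom.comp_apply, linSubst_X, linSubst_X, map_sum]
  simp only [map_mul, algHom_C, MvPolynomial.algebraMap_eq, linSubst_X, Matrix.mul_apply,
    Int.cast_sum, Int.cast_mul, map_sum, Finset.mul_sum, Finset.sum_mul]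
  rw [Finset.sum_comm]
  exact Finset.sum_congr rfl fun k _ => Finset.sum_congr rfl fun j _ => by ring

/-- `linSubst 1 = id`. [folklore] -/
theorem linSubst_one : linSubst (K := K) (1 : Matrix (Fin n) (Fin n) ℤ) = AlgHom.id K _ := by
  classical
  refine algHom_ext fun i => ?_
  rw [linSubst_X, AlgHom.id_apply]
  simp only [Matrix.one_apply]
  rw [Finset.sum_eq_single i (fun j _ hj => by rw [if_neg (Ne.symm hj), Int.cast_zero, C_0, zero_mul])
    (fun h => absurd (Finset.mem_univ i) h), if_pos rfl, Int.cast_one, C_1, one_mul]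

/-- For an inverse pair `U V = V U = 1` the substitution is a `K`-algebra automorphism of `K[X]`.
[folklore] -/
noncomputable def linSubstEquiv {U V : Matrix (Fin n) (Fin n) ℤ} (hUV : U * V = 1)
    (hVU : V * U = 1) : MvPolynomial (Fin n) K ≃ₐ[K] MvPolynomial (Fin n) K :=
  AlgEquiv.ofAlgHom (linSubst U) (linSubst V) (by rw [linSubst_comp, hVU, linSubst_one])
    (by rw [linSubst_comp, hUV, linSubst_one])

/-- The automorphism acts as `linSubst U`. [folklore] -/
@[simp] theorem linSubstEquiv_apply {U V : Matrix (Fin n) (Fin n) ℤ} (hUV : U * V = 1)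
    (hVU : V * U = 1) (p : MvPolynomial (Fin n) K) :
    linSubstEquiv hUV hVU p = linSubst U p := rfl

/-- For an inverse pair, `x ↦ U x` and `x ↦ V x` are mutually inverse on `Kⁿ`. [folklore] -/
theorem intLinMap_intLinMap_of_mul_eq_one {U V : Matrix (Fin n) (Fin n) ℤ} (hVU : V * U = 1)
    (x : Fin n → K) : intLinMap V (intLinMap U x) = x := by
  rw [← intLinMap_mul, hVU, intLinMap_one]

/-- **Vanishing ideals transport**: `I(U S) = (linSubst U)⁻¹ I(S)`. [folklore] -/
theorem vanishingIdeal_image_intLinMap (U : Matrix (Fin n) (Fin n) ℤ) (S : Set (Fin n → K)) :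
    MvPolynomial.vanishingIdeal K (intLinMap U '' S) =
      (MvPolynomial.vanishingIdeal K S).comap (linSubst U) := by
  ext p
  simp only [MvPolynomial.mem_vanishingIdeal_iff, Ideal.mem_comap, Set.forall_mem_image,
    aeval_linSubst]

/-- **Zero loci transport** (inverse pair): `U · Z(I) = Z(linSubst V (I))`. [folklore] -/
theorem image_intLinMap_zeroLocus {U V : Matrix (Fin n) (Fin n) ℤ} (hUV : U * V = 1)
    (hVU : V * U = 1) (I : Ideal (MvPolynomial (Fin n) K)) :
    intLinMap U '' MvPolynomial.zeroLocus K I =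
      MvPolynomial.zeroLocus K (I.map (linSubst V)) := by
  ext y
  rw [Ideal.map, MvPolynomial.zeroLocus_span, Set.mem_setOf_eq, Set.mem_image]
  constructor
  · rintro ⟨x, hx, rfl⟩ p ⟨q, hq, rfl⟩
    rw [aeval_linSubst, intLinMap_intLinMap_of_mul_eq_one hVU]
    exact (MvPolynomial.mem_zeroLocus_iff.1 hx) q hq
  · intro hy
    refine ⟨intLinMap V y, ?_, intLinMap_intLinMap_of_mul_eq_one hUV y⟩
    rw [MvPolynomial.mem_zeroLocus_iff]
    intro q hq
    have h := hy (linSubst V q) ⟨q, hq, rfl⟩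
    rwa [aeval_linSubst] at h

/-- **Closedness transports**: `U · S` is Zariski closed if `S` is (inverse pair). [folklore] -/
theorem isZariskiClosed_image_intLinMap {U V : Matrix (Fin n) (Fin n) ℤ} (hUV : U * V = 1)
    (hVU : V * U = 1) {S : Set (Fin n → K)} (hS : IsZariskiClosed K S) :
    IsZariskiClosed K (intLinMap U '' S) := by
  obtain ⟨I, rfl⟩ := hS
  exact ⟨I.map (linSubst V), image_intLinMap_zeroLocus hUV hVU I⟩

/-- **Irreducibility transports**: `U · S` is an irreducible closed set if `S` is (inverse pair).
[folklore] -/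
theorem isIrreducibleClosed_image_intLinMap {U V : Matrix (Fin n) (Fin n) ℤ} (hUV : U * V = 1)
    (hVU : V * U = 1) {S : Set (Fin n → K)} (hS : IsIrreducibleClosed K S) :
    IsIrreducibleClosed K (intLinMap U '' S) := by
  refine ⟨isZariskiClosed_image_intLinMap hUV hVU hS.1, ?_⟩
  rw [vanishingIdeal_image_intLinMap]
  haveI := hS.2
  exact Ideal.comap_isPrime (linSubst U) _

/-- **Dimension is invariant**: `dim (U · S) = dim S` (inverse pair): the coordinate rings of the
closures are isomorphic through the automorphism `linSubst U`. [folklore] -/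
theorem zariskiDim_image_intLinMap {U V : Matrix (Fin n) (Fin n) ℤ} (hUV : U * V = 1)
    (hVU : V * U = 1) (S : Set (Fin n → K)) :
    zariskiDim K (intLinMap U '' S) = zariskiDim K S := by
  let α : MvPolynomial (Fin n) K ≃ₐ[K] MvPolynomial (Fin n) K := linSubstEquiv hUV hVU
  let f : MvPolynomial (Fin n) K ≃+* MvPolynomial (Fin n) K := α.symm.toRingEquiv
  set I := MvPolynomial.vanishingIdeal K S with hI
  have hmap : I.map (f : MvPolynomial (Fin n) K →+* MvPolynomial (Fin n) K) =
      MvPolynomial.vanishingIdeal K (intLinMap U '' S) := by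
    rw [vanishingIdeal_image_intLinMap, Ideal.map_comap_of_equiv]
    ext p
    simp only [Ideal.mem_comap]
    exact Iff.rfl
  have e : (MvPolynomial (Fin n) K ⧸ I) ≃+*
      (MvPolynomial (Fin n) K ⧸ MvPolynomial.vanishingIdeal K (intLinMap U '' S)) :=
    Ideal.quotientEquiv I _ f hmap.symm
  unfold zariskiDim
  exact (ringKrullDim_eq_of_ringEquiv e).symm

/-- **The base of the transported set has the same dimension**:
`dim cl π(Φ_U(S ∩ Gⁿ)) = dim cl π(S ∩ Gⁿ)`, i.e. `addProjDim` is invariant (inverse pair). [folklore] -/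
theorem addProjDim_latticeImage {U V : Matrix (Fin n) (Fin n) ℤ} (hUV : U * V = 1)
    (hVU : V * U = 1) (S : Set (Fin n ⊕ Fin n → K)) :
    addProjDim K n (latticeImage U S) = addProjDim K n S := by
  rw [addProjDim, addProjDim, latticeImage_inter_torusLocus, projAdd_image_latticeImage,
    zariskiDim_image_intLinMap hUV hVU]

end LinSubst

/-! ## Bridge to the tree's `matrixAct`

`latticeChange U` is, by `rfl`, the map `matrixAct U` of `ExpVarieties` (Zilber's `[M]`); the named
facts `matrixAct_mul` / `matrixAct_mem_expGraph` were discharged in `ExpVarietiesProofs`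
(`matrixAct_mul_holds`, `matrixAct_mem_expGraph_holds`), and through the bridge they give the
functoriality and the `Γ_exp`-stability of `latticeChange` over any (exponential) field. [folklore] -/

section MatrixActBridge

variable {K : Type*} [Field K] {n : ℕ}

/-- `latticeChange U = matrixAct U` (same formula). [folklore] -/
theorem latticeChange_eq_matrixAct (U : Matrix (Fin n) (Fin n) ℤ) (z : Fin n ⊕ Fin n → K) :
    latticeChange U z = matrixAct U z := rfl

/-- As functions: `latticeChange U = matrixAct U`. [folklore] -/
theorem latticeChange_eq_matrixAct' (U : Matrix (Fin n) (Fin n) ℤ) :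
    (latticeChange U : (Fin n ⊕ Fin n → K) → (Fin n ⊕ Fin n → K)) = matrixAct U :=
  funext (latticeChange_eq_matrixAct U)

/-- `latticeImage U S = [U] '' (S ∩ Gⁿ)` in the tree's notation. [folklore] -/
theorem latticeImage_eq_image_matrixAct (U : Matrix (Fin n) (Fin n) ℤ)
    (S : Set (Fin n ⊕ Fin n → K)) : latticeImage U S = matrixAct U '' (S ∩ torusLocus K n) := by
  rw [latticeImage, latticeChange_eq_matrixAct']

/-- `Γ_exp`-stability over ANY exponential field, from the tree's discharge
`matrixAct_mem_expGraph_holds`. [folklore] -/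
theorem latticeChange_mem_expGraph_of_exponentialRing {K : Type*} [Field K]
    [Literature.ModelTheory.ExponentialFields.ExponentialRing K] {n : ℕ}
    (U : Matrix (Fin n) (Fin n) ℤ) {z : Fin n ⊕ Fin n → K} (hz : z ∈ expGraph K n) :
    latticeChange U z ∈ expGraph K n := by
  rw [latticeChange_eq_matrixAct]
  exact matrixAct_mem_expGraph_holds U hz

end MatrixActBridge

/-! ## Transport of freeness and rotundity under `Φ_U` (inverse pair)

For `U V = V U = 1`: if `S ⊆ Kⁿ × Kⁿ` meets the torus in an additively free / multiplicatively
free / rotund set, so does `Φ_U(S ∩ Gⁿ)`.  Additively, a character `m` of `U x` is the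
character `m U` of `x`; multiplicatively, a monomial `m` of `y^U` is the monomial `m U` of `y`; and
`[M] ∘ Φ_U = [M U]` on the torus with `rank (M U) = rank M`.  [folklore] -/

section FreeRotund

variable {K : Type*} [Field K] {n : ℕ}

/-- A character of `U x` is a character of `x`: `∑ᵢ mᵢ (U x)ᵢ = ∑ⱼ (m U)ⱼ xⱼ`. [folklore] -/
theorem sum_mul_intLinMap (m : Fin n → ℤ) (U : Matrix (Fin n) (Fin n) ℤ) (x : Fin n → K) :
    ∑ i, (m i : K) * intLinMap U x i = ∑ j, ((Matrix.vecMul m U) j : K) * x j := by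
  simp only [intLinMap, Matrix.vecMul, dotProduct, Int.cast_sum, Int.cast_mul, Finset.mul_sum,
    Finset.sum_mul]
  rw [Finset.sum_comm]
  exact Finset.sum_congr rfl fun j _ => Finset.sum_congr rfl fun i _ => by ring

/-- A monomial of `y^U` is a monomial of `y` (on the torus): `∏ᵢ (y^U)ᵢ ^ mᵢ = ∏ⱼ yⱼ ^ (m U)ⱼ`.
[folklore] -/
theorem prod_monomialMap_zpow (m : Fin n → ℤ) (U : Matrix (Fin n) (Fin n) ℤ) {y : Fin n → K}
    (hy : ∀ j, y j ≠ 0) :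
    ∏ i, monomialMap U y i ^ m i = ∏ j, y j ^ (Matrix.vecMul m U) j := by
  classical
  -- work in the unit group
  set u : Fin n → Kˣ := fun j => Units.mk0 (y j) (hy j) with hu
  have hyu : y = fun j => (u j : K) := funext fun j => by simp [hu]
  rw [hyu, monomialMap_coe_units]
  simp only [monomialMapUnits, ← Units.val_zpow_eq_zpow_val, ← Units.coe_prod]
  congr 1
  simp only [Matrix.vecMul, dotProduct]
  calc ∏ i, (∏ j, u j ^ U i j) ^ m i
      = ∏ i, ∏ j, u j ^ (U i j * m i) := by
        refine Finset.prod_congr rfl fun i _ => ?_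
        rw [← Finset.prod_zpow]
        exact Finset.prod_congr rfl fun j _ => by rw [← _root_.zpow_mul]
    _ = ∏ j, ∏ i, u j ^ (U i j * m i) := Finset.prod_comm
    _ = ∏ j, u j ^ ∑ i, m i * U i j := by
        refine Finset.prod_congr rfl fun j _ => ?_
        rw [prod_zpow_eq_zpow_sum]
        exact congrArg _ (Finset.sum_congr rfl fun i _ => by ring)

/-- `m U ≠ 0` for `m ≠ 0` and `U` with a right inverse `U V = 1`. [folklore] -/
theorem vecMul_ne_zero_of_mul_eq_one {U V : Matrix (Fin n) (Fin n) ℤ} (hUV : U * V = 1)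
    {m : Fin n → ℤ} (hm : m ≠ 0) : Matrix.vecMul m U ≠ 0 := by
  intro h
  apply hm
  have : Matrix.vecMul (Matrix.vecMul m U) V = m := by
    rw [Matrix.vecMul_vecMul, hUV, Matrix.vecMul_one]
  rw [← this, h, Matrix.zero_vecMul]

/-- **Additive freeness transports** under `Φ_U` (inverse pair). [folklore] -/
theorem isAddFree_latticeImage {U V : Matrix (Fin n) (Fin n) ℤ} (hUV : U * V = 1)
    {S : Set (Fin n ⊕ Fin n → K)} (hS : IsAddFree K n (S ∩ torusLocus K n)) :
    IsAddFree K n (latticeImage U S) := by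
  intro m hm ⟨c, hc⟩
  refine hS (Matrix.vecMul m U) (vecMul_ne_zero_of_mul_eq_one hUV hm) ⟨c, fun z hz => ?_⟩
  have h := hc (latticeChange U z) ⟨z, hz, rfl⟩
  simp only [latticeChange_inl] at h
  rw [sum_mul_intLinMap] at h
  simpa only [projAdd_apply] using h

/-- **Multiplicative freeness transports** under `Φ_U` (inverse pair). [folklore] -/
theorem isMulFree_latticeImage {U V : Matrix (Fin n) (Fin n) ℤ} (hUV : U * V = 1)
    {S : Set (Fin n ⊕ Fin n → K)} (hS : IsMulFree K n (S ∩ torusLocus K n)) :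
    IsMulFree K n (latticeImage U S) := by
  intro m hm ⟨c, hc⟩
  refine hS (Matrix.vecMul m U) (vecMul_ne_zero_of_mul_eq_one hUV hm) ⟨c, fun z hz => ?_⟩
  have h := hc (latticeChange U z) ⟨z, hz, rfl⟩
  simp only [latticeChange_inr] at h
  rw [prod_monomialMap_zpow m U (fun j => projMul_apply z j ▸ hz.2 j)] at h
  simpa only [projMul_apply] using h

/-- `[M] (Φ_U z) = [M U] z` on the torus locus (the tree's functoriality of `matrixAct`).
[folklore] -/
theorem matrixAct_latticeChange (M U : Matrix (Fin n) (Fin n) ℤ) {z : Fin n ⊕ Fin n → K}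
    (hz : z ∈ torusLocus K n) : matrixAct M (latticeChange U z) = matrixAct (M * U) z := by
  rw [latticeChange_eq_matrixAct, matrixAct_mul_holds M U hz]

/-- `[M] '' Φ_U(S ∩ Gⁿ) = [M U] '' (S ∩ Gⁿ)`. [folklore] -/
theorem image_matrixAct_latticeImage (M U : Matrix (Fin n) (Fin n) ℤ)
    (S : Set (Fin n ⊕ Fin n → K)) :
    matrixAct M '' latticeImage U S = matrixAct (M * U) '' (S ∩ torusLocus K n) := by
  rw [latticeImage, Set.image_image]
  exact Set.image_congr fun z hz => matrixAct_latticeChange M U hz.2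

/-- `rank (M U) = rank M` over `ℚ` for `U` with `IsUnit (det U)` after casting; here from an
inverse pair. [folklore] -/
theorem rank_map_mul_of_mul_eq_one {U V : Matrix (Fin n) (Fin n) ℤ} (hUV : U * V = 1)
    (M : Matrix (Fin n) (Fin n) ℤ) :
    ((M * U).map (Int.cast : ℤ → ℚ)).rank = (M.map (Int.cast : ℤ → ℚ)).rank := by
  have hmap : (M * U).map (Int.cast : ℤ → ℚ) = M.map (Int.cast : ℤ → ℚ) * U.map (Int.cast : ℤ → ℚ) :=
    Matrix.map_mul (f := Int.castRingHom ℚ)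
  have hU : IsUnit (U.map (Int.cast : ℤ → ℚ)).det := by
    have h1 : U.map (Int.cast : ℤ → ℚ) * V.map (Int.cast : ℤ → ℚ) = 1 := by
      have h : (U * V).map (Int.cast : ℤ → ℚ) = U.map (Int.cast : ℤ → ℚ) * V.map (Int.cast : ℤ → ℚ) :=
        Matrix.map_mul (f := Int.castRingHom ℚ)
      rw [← h, hUV]
      exact Matrix.map_one _ Int.cast_zero Int.cast_one
    exact Matrix.isUnit_det_of_right_inverse h1
  rw [hmap, Matrix.rank_mul_eq_left_of_isUnit_det _ _ hU]

/-- **Rotundity transports** under `Φ_U` (inverse pair): `dim [M] Φ_U(S ∩ Gⁿ) = dim [M U](S ∩ Gⁿ)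
≥ rank (M U) = rank M`. [folklore] -/
theorem isRotund_latticeImage {U V : Matrix (Fin n) (Fin n) ℤ} (hUV : U * V = 1)
    {S : Set (Fin n ⊕ Fin n → K)} (hS : IsRotund K n (S ∩ torusLocus K n)) :
    IsRotund K n (latticeImage U S) := by
  intro M
  rw [image_matrixAct_latticeImage, ← rank_map_mul_of_mul_eq_one hUV M]
  exact hS (M * U)

/-- The three torus-side binders of a cell at once: for an inverse pair, `Φ_U(S ∩ Gⁿ)` (which is
its own torus part) is rotund, additively free and multiplicatively free if `S ∩ Gⁿ` is.
[folklore] -/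
theorem rotund_free_latticeImage {U V : Matrix (Fin n) (Fin n) ℤ} (hUV : U * V = 1)
    {S : Set (Fin n ⊕ Fin n → K)} (hrot : IsRotund K n (S ∩ torusLocus K n))
    (hadd : IsAddFree K n (S ∩ torusLocus K n)) (hmul : IsMulFree K n (S ∩ torusLocus K n)) :
    IsRotund K n (latticeImage U S ∩ torusLocus K n) ∧
      IsAddFree K n (latticeImage U S ∩ torusLocus K n) ∧
        IsMulFree K n (latticeImage U S ∩ torusLocus K n) := by
  rw [latticeImage_inter_torusLocus]
  exact ⟨isRotund_latticeImage hUV hrot, isAddFree_latticeImage hUV hadd,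
    isMulFree_latticeImage hUV hmul⟩

end FreeRotund

/-! ## `W ∩ Gⁿ` is Zariski dense in an irreducible `W` meeting `Gⁿ`

Elementary form (no topology): the vanishing ideals agree, hence so do the dimensions.  This is
the step "`cl(W ∩ Gⁿ) = W`" by which the cell statements (closed `W ⊆ Kⁿ × Kⁿ` with hypotheses on
`W ∩ Gⁿ`) are moved to and from subvarieties of the torus. [folklore] -/

section TorusDense

variable {K : Type*} [Field K] {n : ℕ}

open MvPolynomial

/-- The product of the multiplicative coordinate functions `∏ⱼ Y_j`. [folklore] -/
noncomputable def mulCoordProd (K : Type*) [Field K] (n : ℕ) :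
    MvPolynomial (Fin n ⊕ Fin n) K :=
  ∏ j, X (Sum.inr j)

/-- `(∏ⱼ Yⱼ)(z) = ∏ⱼ z_{inr j}`. [folklore] -/
theorem eval_mulCoordProd (z : Fin n ⊕ Fin n → K) :
    eval z (mulCoordProd K n) = ∏ j, z (Sum.inr j) := by
  simp only [mulCoordProd, map_prod, eval_X]

/-- `(∏ⱼ Yⱼ)(z) = ∏ⱼ z_{inr j}` (`aeval` form). [folklore] -/
theorem aeval_mulCoordProd (z : Fin n ⊕ Fin n → K) :
    aeval z (mulCoordProd K n) = ∏ j, z (Sum.inr j) := by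
  simp only [mulCoordProd, map_prod, aeval_X]

/-- `(∏ⱼ Yⱼ)(z) ≠ 0 ↔ z ∈ Gⁿ`. [folklore] -/
theorem aeval_mulCoordProd_ne_zero_iff (z : Fin n ⊕ Fin n → K) :
    aeval z (mulCoordProd K n) ≠ 0 ↔ z ∈ torusLocus K n := by
  rw [aeval_mulCoordProd, Finset.prod_ne_zero_iff]
  exact ⟨fun h j => h j (Finset.mem_univ j), fun h j _ => h j⟩

/-- **Density of the torus part**: for an irreducible closed `W` meeting `Gⁿ`,
`I(W ∩ Gⁿ) = I(W)` — a polynomial vanishing on `W ∩ Gⁿ` vanishes on `W`, because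
`p · ∏ⱼ Yⱼ ∈ I(W)` (prime) and `∏ⱼ Yⱼ ∉ I(W)`. [folklore] -/
theorem vanishingIdeal_inter_torusLocus_of_irred {W : Set (Fin n ⊕ Fin n → K)}
    (hW : IsIrreducibleClosed K W) (hne : (W ∩ torusLocus K n).Nonempty) :
    MvPolynomial.vanishingIdeal K (W ∩ torusLocus K n) = MvPolynomial.vanishingIdeal K W := by
  refine le_antisymm (fun p hp => ?_) (MvPolynomial.vanishingIdeal_anti_mono Set.inter_subset_left)
  haveI := hW.2
  have hq : p * mulCoordProd K n ∈ MvPolynomial.vanishingIdeal K W := by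
    rw [MvPolynomial.mem_vanishingIdeal_iff]
    intro z hz
    rw [map_mul]
    by_cases hzT : z ∈ torusLocus K n
    · rw [(MvPolynomial.mem_vanishingIdeal_iff.1 hp) z ⟨hz, hzT⟩, zero_mul]
    · have h0 : aeval z (mulCoordProd K n) = 0 := by
        by_contra h
        exact hzT ((aeval_mulCoordProd_ne_zero_iff z).1 h)
      rw [h0, mul_zero]
  have hπ : mulCoordProd K n ∉ MvPolynomial.vanishingIdeal K W := by
    obtain ⟨z₀, hz₀W, hz₀T⟩ := hne
    intro h
    have h0 := (MvPolynomial.mem_vanishingIdeal_iff.1 h) z₀ hz₀W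
    exact ((aeval_mulCoordProd_ne_zero_iff z₀).2 hz₀T) h0
  exact ((Ideal.IsPrime.mem_or_mem ‹_› hq).resolve_right hπ)

/-- Hence `dim (W ∩ Gⁿ) = dim W` for an irreducible closed `W` meeting the torus. [folklore] -/
theorem zariskiDim_inter_torusLocus_of_irred {W : Set (Fin n ⊕ Fin n → K)}
    (hW : IsIrreducibleClosed K W) (hne : (W ∩ torusLocus K n).Nonempty) :
    zariskiDim K (W ∩ torusLocus K n) = zariskiDim K W := by
  unfold zariskiDim
  rw [vanishingIdeal_inter_torusLocus_of_irred hW hne]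

/-- And `I(W ∩ Gⁿ)` is prime. [folklore] -/
theorem vanishingIdeal_inter_torusLocus_isPrime_of_irred {W : Set (Fin n ⊕ Fin n → K)}
    (hW : IsIrreducibleClosed K W) (hne : (W ∩ torusLocus K n).Nonempty) :
    (MvPolynomial.vanishingIdeal K (W ∩ torusLocus K n)).IsPrime := by
  rw [vanishingIdeal_inter_torusLocus_of_irred hW hne]
  exact hW.2

end TorusDense

/-! ## The Zariski closure of `Φ_U(W ∩ Gⁿ)`: the torus side of the lattice change

For an inverse pair `U V = V U = 1` and an irreducible closed `W ⊆ Lⁿ × Lⁿ` meeting the torus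
(`L` algebraically closed), the Zariski closure `W^U := Z(I(Φ_U(W ∩ Gⁿ)))` is irreducible closed,
its torus part is exactly `Φ_U(W ∩ Gⁿ)`, and `dim W^U = dim W`.  Primality of `I(Φ_U(W ∩ Gⁿ))`
and `dim Φ_U(W ∩ Gⁿ) ≤ dim W` are the tree's `vanishingIdeal_image_matrixAct_eq_ker` /
`zariskiDim_image_matrixAct_le` (generic points, `ExpVarietiesDimension`); the torus part uses
the tree's clearing of denominators `exists_mul_prod_pow_eq_aeval`; the reverse inequality is the
same bound for `V` applied to `W^U`, read through `Φ_V Φ_U = id` and the density of `W ∩ Gⁿ`.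
Together with §FreeRotund and `addProjDim_latticeImage` this moves EVERY binder of a cell
`EC(n,d)` across `Φ_U` (`cell_hypotheses_latticeClosure`, over `ℂ`). [folklore] -/

section TorusTransport

universe u

variable {L : Type u} [Field L] {n : ℕ}

open MvPolynomial

/-- A Zariski closed set is the zero locus of its vanishing ideal. [folklore] -/
theorem zeroLocus_vanishingIdeal_of_isZariskiClosed {ι : Type*} {W : Set (ι → L)}
    (hW : IsZariskiClosed L W) :
    MvPolynomial.zeroLocus L (MvPolynomial.vanishingIdeal L W) = W := by
  obtain ⟨I, rfl⟩ := hW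
  exact le_antisymm
    (MvPolynomial.zeroLocus_anti_mono (MvPolynomial.le_vanishingIdeal_zeroLocus I))
    (MvPolynomial.zeroLocus_vanishingIdeal_le _)

/-- The Zariski closure `W^U := Z(I(Φ_U(W ∩ Gⁿ)))` of the lattice image. [folklore] -/
def latticeClosure (U : Matrix (Fin n) (Fin n) ℤ) (W : Set (Fin n ⊕ Fin n → L)) :
    Set (Fin n ⊕ Fin n → L) :=
  MvPolynomial.zeroLocus L (MvPolynomial.vanishingIdeal L (latticeImage U W))

/-- `Φ_U(W ∩ Gⁿ) ⊆ W^U`. [folklore] -/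
theorem latticeImage_subset_latticeClosure (U : Matrix (Fin n) (Fin n) ℤ)
    (W : Set (Fin n ⊕ Fin n → L)) : latticeImage U W ⊆ latticeClosure U W :=
  MvPolynomial.zeroLocus_vanishingIdeal_le _

/-- `W^U` is Zariski closed. [folklore] -/
theorem isZariskiClosed_latticeClosure (U : Matrix (Fin n) (Fin n) ℤ)
    (W : Set (Fin n ⊕ Fin n → L)) : IsZariskiClosed L (latticeClosure U W) :=
  ⟨_, rfl⟩

/-- `I(W^U) = I(Φ_U(W ∩ Gⁿ))`. [folklore] -/
theorem vanishingIdeal_latticeClosure (U : Matrix (Fin n) (Fin n) ℤ)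
    (W : Set (Fin n ⊕ Fin n → L)) :
    MvPolynomial.vanishingIdeal L (latticeClosure U W) =
      MvPolynomial.vanishingIdeal L (latticeImage U W) :=
  le_antisymm (MvPolynomial.vanishingIdeal_anti_mono (latticeImage_subset_latticeClosure U W))
    (MvPolynomial.le_vanishingIdeal_zeroLocus _)

/-- `dim W^U = dim Φ_U(W ∩ Gⁿ)`. [folklore] -/
theorem zariskiDim_latticeClosure_eq_latticeImage (U : Matrix (Fin n) (Fin n) ℤ)
    (W : Set (Fin n ⊕ Fin n → L)) :
    zariskiDim L (latticeClosure U W) = zariskiDim L (latticeImage U W) := by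
  unfold zariskiDim
  rw [vanishingIdeal_latticeClosure]

/-- `latticeImage V` only sees the torus part. [folklore] -/
theorem latticeImage_congr_inter (V : Matrix (Fin n) (Fin n) ℤ) {S₁ S₂ : Set (Fin n ⊕ Fin n → L)}
    (h : S₁ ∩ torusLocus L n = S₂ ∩ torusLocus L n) : latticeImage V S₁ = latticeImage V S₂ := by
  unfold latticeImage
  rw [h]

/-- **Torus part of the closure** (inverse pair, `W` closed): `W^U ∩ Gⁿ = Φ_U(W ∩ Gⁿ)`.  If
`z' ∈ W^U ∩ Gⁿ` then `Φ_V z' ∈ W`: for `r ∈ I(W)` clear denominators, `r(Φ_V w)·(∏ w_y)^N = a(w)`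
on `Gⁿ`; `a` vanishes on `Φ_U(W ∩ Gⁿ)` (there `Φ_V Φ_U z₀ = z₀ ∈ W`), so `a(z') = 0`, so
`r(Φ_V z') = 0`; and `z' = Φ_U(Φ_V z')`. [folklore] -/
theorem latticeClosure_inter_torusLocus {U V : Matrix (Fin n) (Fin n) ℤ} (hUV : U * V = 1)
    (hVU : V * U = 1) {W : Set (Fin n ⊕ Fin n → L)} (hW : IsZariskiClosed L W) :
    latticeClosure U W ∩ torusLocus L n = latticeImage U W := by
  refine le_antisymm ?_ (Set.subset_inter (latticeImage_subset_latticeClosure U W)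
    (latticeImage_subset_torusLocus U W))
  rintro z' ⟨hz'c, hz'T⟩
  have hVz'T : latticeChange V z' ∈ torusLocus L n := latticeChange_mem_torusLocus V hz'T
  have hVz'W : latticeChange V z' ∈ W := by
    rw [← zeroLocus_vanishingIdeal_of_isZariskiClosed hW, MvPolynomial.mem_zeroLocus_iff]
    intro r hr
    obtain ⟨N, a, hNa⟩ := exists_mul_prod_pow_eq_aeval V r
    have ha : a ∈ MvPolynomial.vanishingIdeal L (latticeImage U W) := by
      rw [MvPolynomial.mem_vanishingIdeal_iff]
      rintro _ ⟨z₀, hz₀, rfl⟩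
      have hw : latticeChange U z₀ ∈ torusLocus L n := latticeChange_mem_torusLocus U hz₀.2
      rw [← hNa (latticeChange U z₀) hw, ← latticeChange_eq_matrixAct,
        latticeChange_latticeChange_of_mul_eq_one hVU hz₀.2,
        (MvPolynomial.mem_vanishingIdeal_iff.1 hr) z₀ hz₀.1, zero_mul]
    have h0 : aeval z' a = 0 := (MvPolynomial.mem_zeroLocus_iff.1 hz'c) a ha
    have h1 := hNa z' hz'T
    rw [h0, ← latticeChange_eq_matrixAct] at h1
    exact (mul_eq_zero.1 h1).resolve_right
      (pow_ne_zero _ (Finset.prod_ne_zero_iff.2 fun i _ => hz'T i))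
  exact ⟨latticeChange V z', ⟨hVz'W, hVz'T⟩, latticeChange_latticeChange_of_mul_eq_one hUV hz'T⟩

/-- `W^U` meets the torus when `W` does. [folklore] -/
theorem latticeClosure_inter_torusLocus_nonempty (U : Matrix (Fin n) (Fin n) ℤ)
    {W : Set (Fin n ⊕ Fin n → L)} (hne : (W ∩ torusLocus L n).Nonempty) :
    (latticeClosure U W ∩ torusLocus L n).Nonempty := by
  obtain ⟨z, hz⟩ := hne
  exact ⟨latticeChange U z, latticeImage_subset_latticeClosure U W ⟨z, hz, rfl⟩,
    latticeChange_mem_torusLocus U hz.2⟩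

variable [IsAlgClosed L]

/-- **`I(Φ_U(W ∩ Gⁿ))` is prime** for an irreducible closed `W` meeting the torus: it is the kernel
of evaluation at `[U] ξ`, `ξ` the generic point of `W` (tree:
`vanishingIdeal_image_matrixAct_eq_ker`). [folklore] -/
theorem vanishingIdeal_latticeImage_isPrime (U : Matrix (Fin n) (Fin n) ℤ)
    {W : Set (Fin n ⊕ Fin n → L)} (hW : IsIrreducibleClosed L W)
    (hne : (W ∩ torusLocus L n).Nonempty) :
    (MvPolynomial.vanishingIdeal L (latticeImage U W)).IsPrime := by
  haveI : (MvPolynomial.vanishingIdeal L W).IsPrime := hW.2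
  have hWZ : MvPolynomial.zeroLocus L (MvPolynomial.vanishingIdeal L W) = W :=
    zeroLocus_vanishingIdeal_of_isZariskiClosed hW.1
  have hne' : (MvPolynomial.zeroLocus L (MvPolynomial.vanishingIdeal L W) ∩ torusLocus L n).Nonempty := by
    rwa [hWZ]
  have key : latticeImage U W = matrixAct U ''
      (MvPolynomial.zeroLocus L (MvPolynomial.vanishingIdeal L W) ∩ torusLocus L n) := by
    rw [latticeImage_eq_image_matrixAct, hWZ]
  rw [key, vanishingIdeal_image_matrixAct_eq_ker (MvPolynomial.vanishingIdeal L W)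
    (isGenericPt_genericPt _) hne' U]
  exact RingHom.ker_isPrime _

/-- **`W^U` is irreducible closed.** [folklore] -/
theorem isIrreducibleClosed_latticeClosure (U : Matrix (Fin n) (Fin n) ℤ)
    {W : Set (Fin n ⊕ Fin n → L)} (hW : IsIrreducibleClosed L W)
    (hne : (W ∩ torusLocus L n).Nonempty) : IsIrreducibleClosed L (latticeClosure U W) := by
  refine ⟨isZariskiClosed_latticeClosure U W, ?_⟩
  rw [vanishingIdeal_latticeClosure]
  exact vanishingIdeal_latticeImage_isPrime U hW hne

/-- `dim Φ_U(W ∩ Gⁿ) ≤ dim W` (tree: `zariskiDim_image_matrixAct_le`). [folklore] -/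
theorem zariskiDim_latticeImage_le (U : Matrix (Fin n) (Fin n) ℤ)
    {W : Set (Fin n ⊕ Fin n → L)} (hW : IsIrreducibleClosed L W)
    (hne : (W ∩ torusLocus L n).Nonempty) : zariskiDim L (latticeImage U W) ≤ zariskiDim L W := by
  haveI : (MvPolynomial.vanishingIdeal L W).IsPrime := hW.2
  have hWZ : MvPolynomial.zeroLocus L (MvPolynomial.vanishingIdeal L W) = W :=
    zeroLocus_vanishingIdeal_of_isZariskiClosed hW.1
  have hne' : (MvPolynomial.zeroLocus L (MvPolynomial.vanishingIdeal L W) ∩ torusLocus L n).Nonempty := by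
    rwa [hWZ]
  have h := zariskiDim_image_matrixAct_le (MvPolynomial.vanishingIdeal L W) hne' U
  rwa [hWZ, ← latticeImage_eq_image_matrixAct] at h

/-- **`dim W^U = dim W`** for an inverse pair. [folklore] -/
theorem zariskiDim_latticeClosure {U V : Matrix (Fin n) (Fin n) ℤ} (hUV : U * V = 1)
    (hVU : V * U = 1) {W : Set (Fin n ⊕ Fin n → L)} (hW : IsIrreducibleClosed L W)
    (hne : (W ∩ torusLocus L n).Nonempty) :
    zariskiDim L (latticeClosure U W) = zariskiDim L W := by
  refine le_antisymm ?_ ?_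
  · rw [zariskiDim_latticeClosure_eq_latticeImage]
    exact zariskiDim_latticeImage_le U hW hne
  · have hW' := isIrreducibleClosed_latticeClosure U hW hne
    have hne' := latticeClosure_inter_torusLocus_nonempty U hne
    have h := zariskiDim_latticeImage_le V hW' hne'
    have hVimg : latticeImage V (latticeClosure U W) = W ∩ torusLocus L n := by
      rw [latticeImage_congr_inter V ((latticeClosure_inter_torusLocus hUV hVU hW.1).trans
        (latticeImage_inter_torusLocus U W).symm), latticeImage_latticeImage_of_mul_eq_one hVU]
    rwa [hVimg, zariskiDim_inter_torusLocus_of_irred hW hne] at h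

/-- **The lattice change on varieties.** For an inverse pair and an irreducible closed `W`
meeting `Gⁿ`: `W^U` is irreducible closed, `W^U ∩ Gⁿ = Φ_U(W ∩ Gⁿ)`, `dim W^U = dim W`.
[folklore] -/
theorem latticeClosure_spec {U V : Matrix (Fin n) (Fin n) ℤ} (hUV : U * V = 1) (hVU : V * U = 1)
    {W : Set (Fin n ⊕ Fin n → L)} (hW : IsIrreducibleClosed L W)
    (hne : (W ∩ torusLocus L n).Nonempty) :
    IsIrreducibleClosed L (latticeClosure U W) ∧
      latticeClosure U W ∩ torusLocus L n = latticeImage U W ∧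
        zariskiDim L (latticeClosure U W) = zariskiDim L W :=
  ⟨isIrreducibleClosed_latticeClosure U hW hne, latticeClosure_inter_torusLocus hUV hVU hW.1,
    zariskiDim_latticeClosure hUV hVU hW hne⟩

omit [IsAlgClosed L] in
/-- The round trip on closures: `(W^U)^V ∩ Gⁿ = W ∩ Gⁿ`. [folklore] -/
theorem latticeClosure_latticeClosure_inter_torusLocus {U V : Matrix (Fin n) (Fin n) ℤ}
    (hUV : U * V = 1) (hVU : V * U = 1) {W : Set (Fin n ⊕ Fin n → L)} (hW : IsZariskiClosed L W) :
    latticeClosure V (latticeClosure U W) ∩ torusLocus L n = W ∩ torusLocus L n := by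
  rw [latticeClosure_inter_torusLocus hVU hUV (isZariskiClosed_latticeClosure U W),
    latticeImage_congr_inter V ((latticeClosure_inter_torusLocus hUV hVU hW).trans
      (latticeImage_inter_torusLocus U W).symm), latticeImage_latticeImage_of_mul_eq_one hVU]

end TorusTransport

/-! ## All binders of a cell move across `Φ_U` (over `ℂ`) -/

section CellTransport

variable {n : ℕ}

/-- `W^U ∩ Γ_exp = Φ_U(W ∩ Gⁿ) ∩ Γ_exp` (as `Γ_exp ⊆ Gⁿ`). [folklore] -/
theorem latticeClosure_inter_expGraph {U V : Matrix (Fin n) (Fin n) ℤ} (hUV : U * V = 1)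
    (hVU : V * U = 1) {W : Set (Fin n ⊕ Fin n → ℂ)} (hW : IsZariskiClosed ℂ W) :
    latticeClosure U W ∩ expGraph ℂ n = latticeImage U W ∩ expGraph ℂ n := by
  ext z
  constructor
  · rintro ⟨hz, hΓ⟩
    have hzT : z ∈ latticeClosure U W ∩ torusLocus ℂ n := ⟨hz, expGraph_subset_torusLocus hΓ⟩
    rw [latticeClosure_inter_torusLocus hUV hVU hW] at hzT
    exact ⟨hzT, hΓ⟩
  · rintro ⟨hz, hΓ⟩
    exact ⟨latticeImage_subset_latticeClosure U W hz, hΓ⟩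

/-- **Every binder of `EC(n,d)` is invariant under the lattice change.** For an inverse pair
`U V = V U = 1` and `W ⊆ ℂⁿ × ℂⁿ` satisfying the hypotheses of the cell `EC(n,d)`, the closure
`W^U` satisfies them too, and `W^U` meets `Γ_exp` iff `W` does.  (So inside any cell statement one
may replace `W` by `W^U`; for the periodic sub-cell this is the reduction "the integer period may
be taken to be `eₙ`", completed by unimodular completion `EACLatticeLemmas` and
`intLinMap_image_transl_invariant`.) [folklore] -/
theorem cell_hypotheses_latticeClosure {d : ℕ} {U V : Matrix (Fin n) (Fin n) ℤ} (hUV : U * V = 1)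
    (hVU : V * U = 1) {W : Set (Fin n ⊕ Fin n → ℂ)} (hW : IsIrreducibleClosed ℂ W)
    (hne : (W ∩ torusLocus ℂ n).Nonempty) (hrot : IsRotund ℂ n (W ∩ torusLocus ℂ n))
    (hadd : IsAddFree ℂ n (W ∩ torusLocus ℂ n)) (hmul : IsMulFree ℂ n (W ∩ torusLocus ℂ n))
    (hdim : zariskiDim ℂ W = n) (hapd : addProjDim ℂ n W = d) :
    IsIrreducibleClosed ℂ (latticeClosure U W) ∧
      (latticeClosure U W ∩ torusLocus ℂ n).Nonempty ∧
      IsRotund ℂ n (latticeClosure U W ∩ torusLocus ℂ n) ∧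
      IsAddFree ℂ n (latticeClosure U W ∩ torusLocus ℂ n) ∧
      IsMulFree ℂ n (latticeClosure U W ∩ torusLocus ℂ n) ∧
      zariskiDim ℂ (latticeClosure U W) = n ∧
      addProjDim ℂ n (latticeClosure U W) = d ∧
      ((latticeClosure U W ∩ expGraph ℂ n).Nonempty ↔ (W ∩ expGraph ℂ n).Nonempty) := by
  have hT : latticeClosure U W ∩ torusLocus ℂ n = latticeImage U W :=
    latticeClosure_inter_torusLocus hUV hVU hW.1
  have hfree := rotund_free_latticeImage hUV hrot hadd hmul
  rw [latticeImage_inter_torusLocus] at hfree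
  refine ⟨isIrreducibleClosed_latticeClosure U hW hne, latticeClosure_inter_torusLocus_nonempty U hne,
    hT ▸ hfree.1, hT ▸ hfree.2.1, hT ▸ hfree.2.2, ?_, ?_, ?_⟩
  · rw [zariskiDim_latticeClosure hUV hVU hW hne, hdim]
  · have h : addProjDim ℂ n (latticeClosure U W) = addProjDim ℂ n (latticeImage U W) := by
      unfold addProjDim
      rw [hT, latticeImage_inter_torusLocus]
    rw [h, addProjDim_latticeImage hUV hVU, hapd]
  · rw [latticeClosure_inter_expGraph hUV hVU hW.1, latticeImage_inter_expGraph_nonempty_iff hVU]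

/-- The additive base of `W^U` is `U · B` where `B` is the base of `W`. [folklore] -/
theorem projAdd_image_latticeClosure_inter {U V : Matrix (Fin n) (Fin n) ℤ} (hUV : U * V = 1)
    (hVU : V * U = 1) {W : Set (Fin n ⊕ Fin n → ℂ)} (hW : IsZariskiClosed ℂ W) :
    projAdd '' (latticeClosure U W ∩ torusLocus ℂ n) =
      intLinMap U '' (projAdd '' (W ∩ torusLocus ℂ n)) := by
  rw [latticeClosure_inter_torusLocus hUV hVU hW, projAdd_image_latticeImage]

end CellTransport

end Literature.ModelTheory.Zilber
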